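import Summits.CriticalPhenomena.CardyFormulaZ2.Theorems.CardyBoundaryCoulombGasBoundaryDefectGaussianRStubRealisabilityPart23

/-!
# The `(2;2)` member of rainbow locality — Part 1: the collar walk of the `(2;2)` datum
# (crux `BoundaryDefectGaussianR`, stmt-CriticalPhenomena-14132; line `rainbow-monomials-in-excursion-kernels`)

The `(2;2)` leg family of the insertion dictionary of
`Literature.Probability.LatticeModels.CollarLegModel`: ONE source `x` with `2` legs and the sink
`y = ι.sink` (with `2` legs). For such a datum `ι` (`ι.source = {x}`, `ι.legs x = 2`), ADMISSIBLE on
`V`, the counter-clockwise collar walk from the sink's dart `d₀ = (y, K_y)` is completely explicit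
(notation of Parts 7/8/21/22 of `…StubRealisability`: `ds = cycle V d₀`, `P = ds.length`, `st t` the
state after `t` darts):

* `r22_sinkLegs` — `L = 2`; `r22_index_x` — the source's exterior dart `(x, K_x) = outDart V x` is
  `ds[tₓ]` for a unique `1 ≤ tₓ < P`; `r22_startAt_none` — no other dart after the sink's starts an
  insertion;
* `r22_st` — **the level profile**: `st 0 = ⟨-2, free, 0, 0⟩`, `st t = ⟨0, free, 0, +1⟩` for
  `1 ≤ t ≤ tₓ` (jump edge `-2 → 0` at the sink), `st t = ⟨-2, free, 0, -1⟩` for `tₓ < t ≤ P` (jump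
  edge `0 → -2` at the source); in particular NO stretch is wired (`r22_not_wired`);
* `r22_arc`, `r22_pocket`, `r22_cells` — hence the jump collar has no arc, no pocket, no ghost and
  no frozen open edge: its vertex-cells are `V`, the completed configuration of `ω` is `ω` itself
  (`r22_cfgOf`), and a corner is tracked iff its vertex lies in `V` (`r22_isTracked_iff`);
* `r22_strandEnds` — **the four strand ends**: `(y, K_y + 3)` and `(x, K_x)` tagged `-2`,
  `(y, K_y)` and `(x, K_x + 3)` tagged `-1` (the finish / start at the two jump edges).

Registered one-line form: `s18_rainbow22_part1` (no wired stretch, no frozen open edge, vertex-cells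
`V`). All [folklore] bookkeeping over the definitions; the unit test `(2;2)` of Part 7's module
docstring is the instance `V = [0,3]×[0,1]`, `y = (2,0)`, `x = (1,0)`.
-/

namespace Summit.CriticalPhenomena.CardyFormulaZ2.Cruxes.BoundaryDefectGaussianR.RainbowMonomialsInExcursionKernels

open Finset Literature.Probability.LatticeModels Literature.Probability.LatticeModels.CollarLegModel

section Datum

variable (ι : LegInsertionData) (V : Finset (ℤ × ℤ)) {x : ℤ × ℤ} (hsrc : ι.source = {x})
  (hlegs : ι.legs x = 2)

include hsrc hlegs in
/-- The sink of a `(2;2)` datum carries `2` legs. [folklore] -/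
theorem r22_sinkLegs : ι.sinkLegs = 2 := by
  rw [LegInsertionData.sinkLegs, hsrc, sum_singleton, hlegs]

include hsrc hlegs in
/-- The initial state of a `(2;2)` datum: level `-2`, free, nothing pending. [folklore] -/
theorem r22_init : ι.init = ⟨-2, false, 0, 0⟩ := by
  rw [LegInsertionData.init, r22_sinkLegs ι hsrc hlegs]
  rfl

variable {d₀ : Dart} (hadm : ι.IsAdmissible V) (h : outDart V ι.sink = some d₀) {st : ℕ → WalkState}
  (hst : ∀ t, st t = List.foldl (fun s d => s.step (ι.startAt V d)) ι.init ((cycle V d₀).take t))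

include hadm hsrc in
/-- The source `x` has a unique exterior dart `outDart V x = (x, K_x)`. [folklore] -/
theorem r22_outDart_x : ∃ K : Fin 4, outDart V x = some (x, K) ∧ x + dir K ∉ V ∧
    ∀ k' : Fin 4, x + dir k' ∉ V → k' = K := by
  have hx : x ∈ insert ι.sink ι.source := by rw [hsrc]; simp
  obtain ⟨-, hcard, -⟩ := hadm.2.2.2.1 x hx
  exact s3_outDart_of_card V x hcard

include hadm h hsrc in
/-- The sink's dart is not a dart at the source. [folklore] -/
theorem r22_sinkDart_fst_ne : d₀.1 ≠ x := by
  intro hx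
  have h1 := (s3_outDart_some V ι.sink d₀ h).1
  have : ι.sink ∈ ι.source := by rw [hsrc, ← hx, h1]; simp
  exact hadm.2.2.1 this

include hadm h hst hsrc in
/-- **The source's dart on the cycle**: `outDart V x = ds[tₓ]` for some `1 ≤ tₓ < P`. [folklore] -/
theorem r22_index_x {K : Fin 4} (hK : outDart V x = some (x, K)) :
    ∃ tₓ : ℕ, 1 ≤ tₓ ∧ ∃ (_ : tₓ < (cycle V d₀).length), (cycle V d₀)[tₓ] = (x, K) := by
  have hx : x ∈ insert ι.sink ι.source := by rw [hsrc]; simp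
  obtain ⟨-, hcard, e, he, hex⟩ := hadm.2.2.2.1 x hx
  obtain ⟨t, ht, rfl⟩ := (mem_walk_iff_st ι V h hst).1 he
  have hex' : ((cycle V d₀)[t]).1 = x := hex
  obtain ⟨K', hK', -, huniq⟩ := s3_outDart_of_card V x hcard
  have hKK : K' = K := by
    have := hK'.symm.trans hK
    simpa using this
  subst hKK
  have hext := se_cycle_exterior ι V hadm h ht
  have hd : (cycle V d₀)[t] = (x, K') := by
    have h2 : ((cycle V d₀)[t]).2 = K' := by
      refine huniq _ ?_
      have := hext.2
      rw [dartTip, hex'] at this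
      exact this
    exact Prod.ext hex' h2
  refine ⟨t, ?_, ht, hd⟩
  rcases Nat.eq_zero_or_pos t with rfl | hpos
  · exfalso
    have h00 : (cycle V d₀)[0] = d₀ := by simp [cycle]
    exact r22_sinkDart_fst_ne ι V hsrc hadm h (by rw [← h00, hd])
  · exact hpos

include hadm h hsrc in
/-- **No other start**: a dart of the cycle after the sink's that is not the source's dart starts no
insertion. [folklore] -/
theorem r22_startAt_none {K : Fin 4} (hK : outDart V x = some (x, K)) {t : ℕ} (ht1 : 1 ≤ t)
    (ht : t < (cycle V d₀).length) (hne : (cycle V d₀)[t] ≠ (x, K)) :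
    ι.startAt V (cycle V d₀)[t] = none := by
  by_contra hs
  obtain ⟨⟨L', σ⟩, hso⟩ := Option.ne_none_iff_exists'.1 hs
  obtain ⟨-, hout, -, -, hσ⟩ := se_startAt_some ι V hadm h hso
  rcases hσ with ⟨-, hd⟩ | ⟨-, hmem⟩
  · have h00 : (cycle V d₀)[0]'(by omega) = d₀ := by simp [cycle]
    have := se_cycle_index_inj ι V hadm h ht (by omega : 0 < _) (hd.trans h00.symm)
    omega
  · rw [hsrc, mem_singleton] at hmem
    rw [hmem] at hout
    exact hne (Option.some.inj (hout.symm.trans hK))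

include hadm hsrc hlegs in
/-- The source's dart starts the insertion `(2, -1)`. [folklore] -/
theorem r22_startAt_x {K : Fin 4} (hK : outDart V x = some (x, K)) : ι.startAt V (x, K) = some (2, -1) := by
  unfold LegInsertionData.startAt
  have h1 : outDart V ι.sink ≠ some (x, K) := by
    intro h'
    have hsx : x = ι.sink := (s3_outDart_some V ι.sink (x, K) h').1
    exact hadm.2.2.1 (by rw [hsrc, mem_singleton, hsx])
  rw [if_neg h1, if_pos ⟨by rw [hsrc]; exact mem_singleton_self _, hK⟩, hlegs]

include hadm h hst hsrc hlegs in
/-- The state after the sink's dart: the jump edge `-2 → 0`, free, nothing pending, sign `+1`. [folklore] -/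
theorem r22_st_one : st 1 = ⟨0, false, 0, 1⟩ := by
  obtain ⟨h1, h2, h3, h4⟩ := st_one ι V hadm h hst
  rw [r22_sinkLegs ι hsrc hlegs] at h3 h4
  norm_num at h3 h4
  rcases hs : st 1 with ⟨l, w, pnd, sg⟩
  rw [hs] at h1 h2 h3 h4
  simp only at h1 h2 h3 h4
  subst h1 h2 h3 h4
  rfl

include hadm h hst hsrc hlegs in
/-- **The level profile of the `(2;2)` walk**: `⟨-2, f, 0, 0⟩` before the sink's dart, `⟨0, f, 0, +1⟩`
after it up to the source's dart `ds[tₓ]`, `⟨-2, f, 0, -1⟩` after the source's dart. [folklore] -/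
theorem r22_st {K : Fin 4} (hK : outDart V x = some (x, K)) {tₓ : ℕ} (htₓ : tₓ < (cycle V d₀).length)
    (hds : (cycle V d₀)[tₓ] = (x, K)) :
    ∀ t ≤ (cycle V d₀).length, st t = if t = 0 then ⟨-2, false, 0, 0⟩
      else if t ≤ tₓ then ⟨0, false, 0, 1⟩ else ⟨-2, false, 0, -1⟩ := by
  have htx1 : 1 ≤ tₓ := by
    rcases Nat.eq_zero_or_pos tₓ with rfl | hpos
    · exfalso
      have h00 : (cycle V d₀)[0] = d₀ := by simp [cycle]
      exact r22_sinkDart_fst_ne ι V hsrc hadm h (by rw [← h00, hds])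
    · exact hpos
  intro t
  induction t with
  | zero => intro; rw [if_pos rfl, hst, List.take_zero, List.foldl_nil, r22_init ι hsrc hlegs]
  | succ t ih =>
    intro ht
    rw [if_neg (Nat.succ_ne_zero t)]
    rcases Nat.eq_zero_or_pos t with rfl | hpos
    · rw [if_pos htx1]; exact r22_st_one ι V hsrc hlegs hadm h hst
    have ih' := ih (by omega)
    rw [if_neg (by omega)] at ih'
    rw [st_succ ι V hst (by omega), ih']
    by_cases htt : t = tₓ
    · subst htt
      rw [if_pos le_rfl, if_neg (by omega), hds, r22_startAt_x ι V hsrc hlegs hadm hK]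
      rfl
    · have hne : (cycle V d₀)[t] ≠ (x, K) := fun he =>
        htt (se_cycle_index_inj ι V hadm h (by omega) htₓ (he.trans hds.symm))
      rw [r22_startAt_none ι V hsrc hadm h hK hpos (by omega) hne]
      by_cases hle : t ≤ tₓ
      · rw [if_pos hle, if_pos (by omega)]; rfl
      · rw [if_neg hle, if_neg (by omega)]; rfl

include hadm h hst hsrc hlegs in
/-- **No stretch of the `(2;2)` walk is wired** (all levels are even). [folklore] -/
theorem r22_not_wired : ∀ t ≤ (cycle V d₀).length, (st t).wired = false := by
  obtain ⟨K, hK, -, -⟩ := r22_outDart_x ι V hsrc hadm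
  obtain ⟨tₓ, -, htₓ, hds⟩ := r22_index_x ι V hsrc hadm h hst hK
  intro t ht
  rw [r22_st ι V hsrc hlegs hadm h hst hK htₓ hds t ht]
  split_ifs <;> rfl

include hadm h hst hsrc hlegs in
/-- The jump collar of a `(2;2)` datum has no Dirichlet arc. [folklore] -/
theorem r22_arc : (ι.collar V).arc = ∅ := by
  ext v
  simp only [Finset.notMem_empty, iff_false]
  rw [mem_collar_arc_iff ι V h hst]
  rintro ⟨t, ht, hw, -⟩
  have h1 := r22_not_wired ι V hsrc hlegs hadm h hst t ht.le
  have h2 := r22_not_wired ι V hsrc hlegs hadm h hst (t + 1) ht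
  rcases hw with hw | hw
  · rw [h1] at hw; exact Bool.false_ne_true hw
  · rw [h2] at hw; exact Bool.false_ne_true hw

include hadm h hst hsrc hlegs in
/-- The jump collar of a `(2;2)` datum has no pocket. [folklore] -/
theorem r22_pocket : (ι.collar V).pocket = ∅ := by
  ext f
  simp only [Finset.notMem_empty, iff_false]
  rw [mem_collar_pocket_iff ι V h hst]
  rintro ⟨t, ht, hw, -⟩
  have h2 := r22_not_wired ι V hsrc hlegs hadm h hst (t + 1) ht
  rw [h2] at hw; exact Bool.false_ne_true hw

include hadm h hst hsrc hlegs in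
/-- **The strand ends of a `(2;2)` datum, by position**: two at the sink's jump edge (dart `0`), two
at the source's (dart `tₓ`), none elsewhere. [folklore] -/
theorem r22_endsAt {K : Fin 4} (hK : outDart V x = some (x, K)) {tₓ : ℕ} (htₓ : tₓ < (cycle V d₀).length)
    (hds : (cycle V d₀)[tₓ] = (x, K)) {t : ℕ} (ht : t < (cycle V d₀).length) :
    LegInsertionData.endsAt ((cycle V d₀)[t], st t, st (t + 1)) =
      if t = 0 then [((toSite d₀.1, d₀.2 + 3), -2), ((toSite d₀.1, d₀.2), -1)]
      else if t = tₓ then [((toSite x, K + 3), -1), ((toSite x, K), -2)] else [] := by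
  have hprof := r22_st ι V hsrc hlegs hadm h hst hK htₓ hds
  have htx1 : 1 ≤ tₓ := by
    rcases Nat.eq_zero_or_pos tₓ with rfl | hpos
    · exfalso
      have h00 : (cycle V d₀)[0] = d₀ := by simp [cycle]
      exact r22_sinkDart_fst_ne ι V hsrc hadm h (by rw [← h00, hds])
    · exact hpos
  have hs0 := hprof t ht.le
  have hs1 := hprof (t + 1) ht
  rw [if_neg (Nat.succ_ne_zero _)] at hs1
  by_cases ht0 : t = 0
  · subst ht0
    rw [if_pos rfl] at hs0
    rw [if_pos htx1] at hs1
    have h00 : (cycle V d₀)[0] = d₀ := by simp [cycle]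
    rw [if_pos rfl, h00, hs0, hs1, se_endsAt_jump _ _ _ (Or.inl (by norm_num))]
    norm_num
  rw [if_neg ht0] at hs0 ⊢
  by_cases htt : t = tₓ
  · subst htt
    rw [if_pos le_rfl] at hs0
    rw [if_neg (by omega)] at hs1
    rw [if_pos rfl, hds, hs0, hs1, se_endsAt_jump _ _ _ (Or.inr (by norm_num))]
    norm_num
  · rw [if_neg htt]
    apply se_endsAt_nil
    rw [hs0, hs1]
    by_cases hle : t ≤ tₓ
    · rw [if_pos hle, if_pos (by omega)]
    · rw [if_neg hle, if_neg (by omega)]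

include hadm h hst hsrc hlegs in
/-- **The four strand ends of a `(2;2)` datum** (sink's dart `d₀ = (y, K_y)`, source's dart
`(x, K_x)`): the finish `(y, K_y + 3)` and the start `(x, K_x)` tagged `-2`, the start `(y, K_y)` and
the finish `(x, K_x + 3)` tagged `-1`. [folklore] -/
theorem r22_mem_strandEnds_iff {K : Fin 4} (hK : outDart V x = some (x, K)) (e : (Site 2 × Fin 4) × ℤ) :
    e ∈ ι.strandEnds V ↔ e = ((toSite d₀.1, d₀.2 + 3), -2) ∨ e = ((toSite d₀.1, d₀.2), -1) ∨
      e = ((toSite x, K + 3), -1) ∨ e = ((toSite x, K), -2) := by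
  obtain ⟨tₓ, htx1, htₓ, hds⟩ := r22_index_x ι V hsrc hadm h hst hK
  have hE := fun t (ht : t < (cycle V d₀).length) => r22_endsAt ι V hsrc hlegs hadm h hst hK htₓ hds ht
  rw [se_mem_strandEnds_iff ι V h hst]
  constructor
  · rintro ⟨t, ht, he⟩
    rw [hE t ht] at he
    split_ifs at he with h1 h2
    · simp only [List.mem_cons, List.not_mem_nil, or_false] at he
      rcases he with h' | h'
      · exact Or.inl h'
      · exact Or.inr (Or.inl h')
    · simp only [List.mem_cons, List.not_mem_nil, or_false] at he
      rcases he with h' | h'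
      · exact Or.inr (Or.inr (Or.inl h'))
      · exact Or.inr (Or.inr (Or.inr h'))
    · simp at he
  · have h0 := hE 0 (by omega)
    rw [if_pos rfl] at h0
    have hx := hE tₓ htₓ
    rw [if_neg (by omega), if_pos rfl] at hx
    rintro (rfl | rfl | rfl | rfl)
    · exact ⟨0, by omega, by rw [h0]; simp⟩
    · exact ⟨0, by omega, by rw [h0]; simp⟩
    · exact ⟨tₓ, htₓ, by rw [hx]; simp⟩
    · exact ⟨tₓ, htₓ, by rw [hx]; simp⟩

end Datum

/-! ### The cells of the jump collar of a `(2;2)` datum -/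

section Cells

variable (ι : LegInsertionData) (V : Finset (ℤ × ℤ)) {x : ℤ × ℤ} (hsrc : ι.source = {x})
  (hlegs : ι.legs x = 2) (hadm : ι.IsAdmissible V)
include hsrc hlegs hadm

/-- **The cells of the `(2;2)` collar**: no arc vertex, no pocket, no ghost, no frozen open edge. [folklore] -/
theorem r22_cells : (ι.model V).arcVerts = ∅ ∧ (ι.model V).pockets = ∅ ∧ (ι.model V).ghosts = ∅ ∧
    (ι.model V).openEdges = ∅ := by
  obtain ⟨d₀, h, -⟩ := s3_of_admissible ι V hadm
  have harc : (ι.collar V).arc = ∅ := r22_arc ι V hsrc hlegs hadm h (st := fun t =>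
    List.foldl (fun s d => s.step (ι.startAt V d)) ι.init ((cycle V d₀).take t)) (fun _ => rfl)
  have hpk : (ι.collar V).pocket = ∅ := r22_pocket ι V hsrc hlegs hadm h (st := fun t =>
    List.foldl (fun s d => s.step (ι.startAt V d)) ι.init ((cycle V d₀).take t)) (fun _ => rfl)
  have h1 : (ι.model V).arcVerts = ∅ := by
    rw [arcVerts, show (ι.model V).C = ι.collar V from rfl, harc, empty_inter]
  have h2 : (ι.model V).pockets = ∅ := by
    rw [pockets, show (ι.model V).C = ι.collar V from rfl, hpk, empty_inter]
  have h3 : (ι.model V).ghosts = ∅ := by simp [ghosts, h1, h2]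
  refine ⟨h1, h2, h3, ?_⟩
  simp [openEdges, h1, h2, h3]

/-- The vertex-cells of the `(2;2)` collar are the vertices of `V`. [folklore] -/
theorem r22_vertexCells : (ι.model V).vertexCells = V := by
  rw [vertexCells, (r22_cells ι V hsrc hlegs hadm).2.2.1, union_empty]
  rfl

/-- **The completed configuration of `ω` is `ω`** (no frozen open edge). [folklore] -/
theorem r22_cfgOf (ω : Finset ((ℤ × ℤ) × Bool)) :
    (ι.model V).cfgOf ω = ↑(ω.image edgeSym2) := by
  rw [cfgOf, (r22_cells ι V hsrc hlegs hadm).2.2.2, union_empty]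

/-- **A corner is tracked iff its vertex lies in `V`.** [folklore] -/
theorem r22_isTracked_iff (c : Site 2 × Fin 4) : (ι.model V).IsTracked c ↔ ofSite c.1 ∈ V := by
  rw [IsTracked, r22_vertexCells ι V hsrc hlegs hadm]
  refine ⟨fun hc => hc.1, fun hc => ⟨hc, ?_⟩⟩
  obtain ⟨c1, k⟩ := c
  have hc1 : c1 = toSite (ofSite c1) := by
    funext i; fin_cases i <;> simp [toSite, ofSite]
  rw [hc1, ofSite_cFace_toSite]
  refine mem_faceCells_of_mem_vertexFaces _ hc ?_
  fin_cases k <;> simp [SixVertex.vertexFaces]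

end Cells


/-! ### Registered one-line form -/

/-- **Sub-goal `s18_rainbow22_part1`** (registered on stmt-CriticalPhenomena-14132; Part 1 of the `(2;2)`
member of rainbow locality): the jump collar of an admissible `(2;2)` datum has no frozen open edge,
its vertex-cells are `V`, and the completed configuration of any `ω` is `ω` read as lattice edges. [folklore] -/
theorem s18_rainbow22_part1 : ∀ (ι : Literature.Probability.LatticeModels.CollarLegModel.LegInsertionData) (V : Finset (ℤ × ℤ)) (x : ℤ × ℤ), ι.source = {x} → ι.legs x = 2 → ι.IsAdmissible V → (ι.model V).openEdges = ∅ ∧ (ι.model V).vertexCells = V ∧ ∀ ω : Finset ((ℤ × ℤ) × Bool), (ι.model V).cfgOf ω = ↑(ω.image Literature.Probability.LatticeModels.CollarLegModel.edgeSym2) :=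
  fun ι V _ hsrc hlegs hadm => ⟨(r22_cells ι V hsrc hlegs hadm).2.2.2, r22_vertexCells ι V hsrc hlegs hadm,
    r22_cfgOf ι V hsrc hlegs hadm⟩

end Summit.CriticalPhenomena.CardyFormulaZ2.Cruxes.BoundaryDefectGaussianR.RainbowMonomialsInExcursionKernels
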